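import Literature.MathematicalPhysics.QuantumLattice.HubbardTTPrimeDiagHopTransport
import HarnessLib

/-!
# Cap-class certificate transport across a `t'`-cell from the OTHER column:
# the anchor energy of every ground state of the cell is below the far column's tangent at the anchor

Family `hubbard` (topic `MathematicalPhysics/QuantumLattice`); written for stage S2
"certifier-families" of the Hubbard material-oracle programme, seat `hubbard-box-p3` (the
`t'`-direction transport lemmas); companion of `HubbardTTPrimeDiagHopTransport` §3–§4 (ONE capped
anchor: window inflation `u₀ + |s − s₀|·(A − B)`) and of `HubbardTTPrimeTwoColumnCaps` (the energy cap
between two capped columns). Notation as there: `e(t,t',U,n) = energyDensityTT' t t' U n`;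
`Φ(t,t',U) = hubbardTTPrimeFermionInteraction t t' U`; `e_Φ(ω) = ω.meanEnergy Φ 1`;
`K₂(ω) = e_{Φ(0,1,0)}(ω)` (`= -HOP2`); "torus-limit ground state at `(t,s,U)`, density `n`" = torus
limit along `Ls → ∞` of unit ground states of `hubbardTorusTT' (Ls j) t s U` in the sectors
`(rectN n (Ls j), S^z = 0)`; ceiling word `A₁` at `s₁`: `K₂(ω₁) ≤ A₁` for every such `ω₁` at
`(t,s₁,U)`; floor word `B₂` at `s₂`: `B₂ ≤ K₂(ω₂)` at `(t,s₂,U)`.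

THE POINT. A certificate solved at an anchor `s₀` whose state hypotheses are an energy CAP
`e_{Φ(t,s₀,U)}(ω) ≤ u` plus state-independent rows speaks about a ground state `ω` of the model at
another `t' = s` as soon as `e_{Φ(t,s₀,U)}(ω) ≤ u` is certified. By linearity,
`e_{Φ(t,s₀,U)}(ω) = e(t,s,U,n) + (s₀ − s)·K₂(ω)` — the TANGENT LINE of the concave `t' ↦ e` at `s`,
evaluated at the anchor. Tangent lines of a concave function evaluated at a fixed point move
monotonically with the contact point, so over a cell the worst case is the FAR END, and the far
column's own data bound it:

* §1 `IsTorusLimitOf.meanEnergy_anchor_le_of_leftColumn`: for `s₁ ≤ s ≤ s₀`, a cap `e(t,s₁,U,n) ≤ R₁`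
  and a ceiling word `A₁` at `s₁` give `e_{Φ(t,s₀,U)}(ω) ≤ R₁ + (s₀ − s₁)·A₁` for EVERY torus-limit
  ground state `ω` at `(t,s,U)` — uniformly in `s`, with NO data at the anchor;
  `IsTorusLimitOf.meanEnergy_anchor_le_of_rightColumn`: for `s₀ ≤ s ≤ s₂`, a cap `R₂` and a floor word
  `B₂` at `s₂` give `e_{Φ(t,s₀,U)}(ω) ≤ R₂ − (s₂ − s₀)·B₂`; both sides:
  `IsTorusLimitOf.meanEnergy_anchor_le_of_outerColumns` (`≤ max` of the two) and the window form with
  the variational lower end `e(t,s₀,U,n)`. Compared with §3 of `HubbardTTPrimeDiagHopTransport`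
  (`≤ u₀ + (s₀ − s₁)(A₁ − B₀)`, resp. `u₀ + (s₂ − s₀)(A₀ − B₂)`), the far column's certified cap `R₁`
  replaces the anchor's own tangent cap `u₀ − (s₀ − s₁)B₀` at `s₁` (resp. `R₂` replaces
  `u₀ + (s₂ − s₀)A₀`): better exactly when the far column carries a genuine (variational) upper bound
  below the anchor's tangent there, and one word per side instead of two.
* §2 Word-free: the far cap alone, with the kinematic row `|K₂| ≤ 16/π²`
  (`…_of_leftCap_kinematic`, `…_of_rightCap_kinematic`: `≤ R + (16/π²)·gap`, against the one-anchor
  `e(t,s₀,U,n) + (32/π²)|s − s₀|`).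
* §3 BOX ⇒ WORD (the shape of `forall_groundState_tPrime_box_of_forall_cap`): a property `P` holding
  for every torus limit of unit `rectN n`-vectors with `e_{Φ(t,s₀,U)} ≤ u` holds for every torus-limit
  ground state at every `t'` of `[s₁, s₀]` if `R₁ + (s₀ − s₁)A₁ ≤ u`, of `[s₀, s₂]` if
  `R₂ − (s₂ − s₀)B₂ ≤ u`, of `[s₁, s₂] ∋ s₀` if both (`forall_groundState_tPrime_cell_of_forall_cap_…`).

HONEST FRAMING: bookkeeping of linearity in `t'`, the Hellmann–Feynman tangent inequality and the
antitonicity of `K₂` for the systematic → certified interface; no number is produced here, every cap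
and word is a hypothesis to be discharged by a certified row, and nothing here bears on
superconductivity by itself. Everything is PROVED; no definition, no named fact, no numerical input.

## Mathlib / tree search

REUSED: `InfVolFermionState.meanEnergy_hubbardTTPrime_affine` (`HubbardTTPrimeMeanEnergySupergradient`
§1), `IsTorusLimitOf.meanEnergy_hubbardTTPrime_eq_energyDensityTT'`,
`IsTorusLimitOf.energyDensityTT'_le_meanEnergy_hubbardTTPrime`, `IsTorusLimitOf.abs_meanEnergy_diagHop_le`
(`HubbardOneBodyKinematicRows`), `IsTorusLimitOf.meanEnergy_diagHop_le_of_forall_left`,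
`IsTorusLimitOf.le_meanEnergy_diagHop_of_forall_right`, `energyDensityTT'_sub_le_mul_of_forall_diagHop_le`,
`mul_le_energyDensityTT'_sub_of_forall_le_diagHop`, `energyDensityTT'_le_of_upperBound_tPrime_kinematic`
(`HubbardTTPrimeDiagHopTransport` §1, §5), `mem_szSector_iff`. `lean search 'anchor_le_of_.*Column|
of_outerColumns|cell_of_forall_cap'` in `Literature/`: no prior statement; the tree's cap transport is
the one-anchor §3–§4 of `HubbardTTPrimeDiagHopTransport`.

## References

* T. Koma, H. Tasaki, J. Stat. Phys. 76 (1994) 745, §1 (the conjugate observable is a supergradient of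
  the concave ground-state energy in a linear coupling). [cite: KomaTasaki1994, §1]
* R. B. Griffiths, Phys. Rev. 152 (1966) 240, §II (one-sided derivatives of the energy bound the
  conjugate expectation in every ground state; monotonicity in the coupling). [cite: Griffiths1966, §II]
* J. Wang et al., *Certifying ground-state properties of many-body systems*, Phys. Rev. X 14 (2024)
  031006, §III (a relaxation certificate constrains every state below an energy cap). [cite: WangEtAl2024, §III]
* R. B. Israel, *Convexity in the Theory of Lattice Gases*, Princeton (1979), Thm. I.3.4 (tangent
  functionals are global affine majorants). [cite: Israel1979, Thm. I.3.4]
-/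

noncomputable section

namespace Literature.MathematicalPhysics.QuantumLattice

open Matrix Finset HubbardWave0 Literature.Probability.LatticeModels ThermodynamicLimit
open _root_.Filter
open scoped _root_.Topology ComplexOrder BigOperators

namespace InfVolFermionState

/-! ### §1 The anchor energy of a cell ground state from the far column's cap and word -/

/-- **Anchor energy from the LEFT column.** For `s₁ ≤ s ≤ s₀` (same `t`, `U ≥ 0`, density
`0 ≤ n < 2`), a certified cap `e(t,s₁,U,n) ≤ R₁` and a ceiling word `A₁` at `s₁`: every torus-limit
ground state `ω` at `(t,s,U)` has `e_{Φ(t,s₀,U)}(ω) ≤ R₁ + (s₀ − s₁)·A₁` (linearity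
`e_{Φ(t,s₀,U)}(ω) = e(t,s,U,n) + (s₀ − s)K₂(ω)`, the tangent `e(t,s,U,n) ≤ R₁ + A₁(s − s₁)` from the
column, and `K₂(ω) ≤ A₁` by antitonicity). Uniform in `s`; no data at the anchor is used.
[cite: KomaTasaki1994, §1] [cite: Griffiths1966, §II] -/
theorem IsTorusLimitOf.meanEnergy_anchor_le_of_leftColumn (t : ℝ) {s₁ s s₀ : ℝ} (hs₁ : s₁ ≤ s)
    (hs₀ : s ≤ s₀) {U : ℝ} (hU : 0 ≤ U) {n : ℝ} (hn0 : 0 ≤ n) (hn2 : n < 2) {R₁ A₁ : ℝ}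
    (hR₁ : energyDensityTT' t s₁ U n ≤ R₁)
    (hA₁ : ∀ (ω₁ : InfVolFermionState 2) (Ls₁ : ℕ → ℕ) (ψ₁ : ∀ L, Fock (Orb (FermionTorus 2 L))),
      Tendsto Ls₁ atTop atTop →
      (∀ j, IsGroundStateInSector (hubbardTorusTT' (Ls₁ j) t s₁ U) (rectN n (Ls₁ j)) 0 (ψ₁ (Ls₁ j))) →
      (∀ j, star (ψ₁ (Ls₁ j)) ⬝ᵥ ψ₁ (Ls₁ j) = 1) → ω₁.IsTorusLimitOf ψ₁ Ls₁ →
      ω₁.meanEnergy (hubbardTTPrimeFermionInteraction 0 1 0) 1 ≤ A₁)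
    {ω : InfVolFermionState 2} {ψ : ∀ L, Fock (Orb (FermionTorus 2 L))} {Ls : ℕ → ℕ}
    (h : ω.IsTorusLimitOf ψ Ls) (hLs : Tendsto Ls atTop atTop)
    (hψ : ∀ j, IsGroundStateInSector (hubbardTorusTT' (Ls j) t s U) (rectN n (Ls j)) 0 (ψ (Ls j)))
    (h1 : ∀ j, star (ψ (Ls j)) ⬝ᵥ ψ (Ls j) = 1) :
    ω.meanEnergy (hubbardTTPrimeFermionInteraction t s₀ U) 1 ≤ R₁ + (s₀ - s₁) * A₁ := by
  have haff := ω.meanEnergy_hubbardTTPrime_affine t s U s₀ U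
  have hgs := h.meanEnergy_hubbardTTPrime_eq_energyDensityTT' t s hU hn0 hn2 hLs hψ h1
  have hK := h.meanEnergy_diagHop_le_of_forall_left t hs₁ hU hn0 hn2 hA₁ hLs hψ h1
  have hup := energyDensityTT'_sub_le_mul_of_forall_diagHop_le t (le_refl s₁) hs₁ hU hn0 hn2 hA₁
  have hprod := mul_le_mul_of_nonneg_left hK (sub_nonneg.2 hs₀)
  rw [haff, hgs, sub_self, zero_mul, add_zero]
  have e : R₁ + (s₀ - s₁) * A₁ = R₁ + A₁ * (s - s₁) + (s₀ - s) * A₁ := by ring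
  rw [e]
  linarith

/-- **Anchor energy from the RIGHT column.** For `s₀ ≤ s ≤ s₂`, a certified cap `e(t,s₂,U,n) ≤ R₂` and
a floor word `B₂` at `s₂`: every torus-limit ground state `ω` at `(t,s,U)` has
`e_{Φ(t,s₀,U)}(ω) ≤ R₂ − (s₂ − s₀)·B₂` (the tangent `e(t,s,U,n) ≤ R₂ − B₂(s₂ − s)` from the column
and `(s₀ − s)K₂(ω) ≤ (s₀ − s)B₂` since `s₀ ≤ s`, `B₂ ≤ K₂(ω)`). Uniform in `s`; no data at the anchor.
[cite: KomaTasaki1994, §1] [cite: Griffiths1966, §II] -/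
theorem IsTorusLimitOf.meanEnergy_anchor_le_of_rightColumn (t : ℝ) {s₀ s s₂ : ℝ} (hs₀ : s₀ ≤ s)
    (hs₂ : s ≤ s₂) {U : ℝ} (hU : 0 ≤ U) {n : ℝ} (hn0 : 0 ≤ n) (hn2 : n < 2) {R₂ B₂ : ℝ}
    (hR₂ : energyDensityTT' t s₂ U n ≤ R₂)
    (hB₂ : ∀ (ω₂ : InfVolFermionState 2) (Ls₂ : ℕ → ℕ) (ψ₂ : ∀ L, Fock (Orb (FermionTorus 2 L))),
      Tendsto Ls₂ atTop atTop →
      (∀ j, IsGroundStateInSector (hubbardTorusTT' (Ls₂ j) t s₂ U) (rectN n (Ls₂ j)) 0 (ψ₂ (Ls₂ j))) →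
      (∀ j, star (ψ₂ (Ls₂ j)) ⬝ᵥ ψ₂ (Ls₂ j) = 1) → ω₂.IsTorusLimitOf ψ₂ Ls₂ →
      B₂ ≤ ω₂.meanEnergy (hubbardTTPrimeFermionInteraction 0 1 0) 1)
    {ω : InfVolFermionState 2} {ψ : ∀ L, Fock (Orb (FermionTorus 2 L))} {Ls : ℕ → ℕ}
    (h : ω.IsTorusLimitOf ψ Ls) (hLs : Tendsto Ls atTop atTop)
    (hψ : ∀ j, IsGroundStateInSector (hubbardTorusTT' (Ls j) t s U) (rectN n (Ls j)) 0 (ψ (Ls j)))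
    (h1 : ∀ j, star (ψ (Ls j)) ⬝ᵥ ψ (Ls j) = 1) :
    ω.meanEnergy (hubbardTTPrimeFermionInteraction t s₀ U) 1 ≤ R₂ - (s₂ - s₀) * B₂ := by
  have haff := ω.meanEnergy_hubbardTTPrime_affine t s U s₀ U
  have hgs := h.meanEnergy_hubbardTTPrime_eq_energyDensityTT' t s hU hn0 hn2 hLs hψ h1
  have hK := h.le_meanEnergy_diagHop_of_forall_right t hs₂ hU hn0 hn2 hB₂ hLs hψ h1
  have hdn := mul_le_energyDensityTT'_sub_of_forall_le_diagHop t hs₂ (le_refl s₂) hU hn0 hn2 hB₂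
  have hprod := mul_le_mul_of_nonpos_left hK (sub_nonpos.2 hs₀)
  rw [haff, hgs, sub_self, zero_mul, add_zero]
  have e : R₂ - (s₂ - s₀) * B₂ = R₂ - B₂ * (s₂ - s) + (s₀ - s) * B₂ := by ring
  rw [e]
  linarith

/-- **Anchor between two capped and worded columns.** For a point `s ∈ [s₁, s₂]` and any anchor `s₀`
(in practice in the cell; no hypothesis on its position is needed), a cap `R₁` and ceiling word `A₁` at `s₁`, a cap `R₂` and floor word
`B₂` at `s₂`: every torus-limit ground state `ω` at `(t,s,U)` has
`e_{Φ(t,s₀,U)}(ω) ≤ max (R₁ + (s₀ − s₁)A₁) (R₂ − (s₂ − s₀)B₂)` (left column if `s ≤ s₀`, right column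
if `s₀ ≤ s`). [cite: KomaTasaki1994, §1] [cite: WangEtAl2024, §III] -/
theorem IsTorusLimitOf.meanEnergy_anchor_le_of_outerColumns (t : ℝ) {s₁ s₂ s₀ s : ℝ}
    (hs : s ∈ Set.Icc s₁ s₂) {U : ℝ} (hU : 0 ≤ U) {n : ℝ} (hn0 : 0 ≤ n)
    (hn2 : n < 2) {R₁ A₁ R₂ B₂ : ℝ}
    (hR₁ : energyDensityTT' t s₁ U n ≤ R₁) (hR₂ : energyDensityTT' t s₂ U n ≤ R₂)
    (hA₁ : ∀ (ω₁ : InfVolFermionState 2) (Ls₁ : ℕ → ℕ) (ψ₁ : ∀ L, Fock (Orb (FermionTorus 2 L))),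
      Tendsto Ls₁ atTop atTop →
      (∀ j, IsGroundStateInSector (hubbardTorusTT' (Ls₁ j) t s₁ U) (rectN n (Ls₁ j)) 0 (ψ₁ (Ls₁ j))) →
      (∀ j, star (ψ₁ (Ls₁ j)) ⬝ᵥ ψ₁ (Ls₁ j) = 1) → ω₁.IsTorusLimitOf ψ₁ Ls₁ →
      ω₁.meanEnergy (hubbardTTPrimeFermionInteraction 0 1 0) 1 ≤ A₁)
    (hB₂ : ∀ (ω₂ : InfVolFermionState 2) (Ls₂ : ℕ → ℕ) (ψ₂ : ∀ L, Fock (Orb (FermionTorus 2 L))),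
      Tendsto Ls₂ atTop atTop →
      (∀ j, IsGroundStateInSector (hubbardTorusTT' (Ls₂ j) t s₂ U) (rectN n (Ls₂ j)) 0 (ψ₂ (Ls₂ j))) →
      (∀ j, star (ψ₂ (Ls₂ j)) ⬝ᵥ ψ₂ (Ls₂ j) = 1) → ω₂.IsTorusLimitOf ψ₂ Ls₂ →
      B₂ ≤ ω₂.meanEnergy (hubbardTTPrimeFermionInteraction 0 1 0) 1)
    {ω : InfVolFermionState 2} {ψ : ∀ L, Fock (Orb (FermionTorus 2 L))} {Ls : ℕ → ℕ}
    (h : ω.IsTorusLimitOf ψ Ls) (hLs : Tendsto Ls atTop atTop)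
    (hψ : ∀ j, IsGroundStateInSector (hubbardTorusTT' (Ls j) t s U) (rectN n (Ls j)) 0 (ψ (Ls j)))
    (h1 : ∀ j, star (ψ (Ls j)) ⬝ᵥ ψ (Ls j) = 1) :
    ω.meanEnergy (hubbardTTPrimeFermionInteraction t s₀ U) 1 ≤
      max (R₁ + (s₀ - s₁) * A₁) (R₂ - (s₂ - s₀) * B₂) := by
  rcases le_total s s₀ with hle | hge
  · exact (h.meanEnergy_anchor_le_of_leftColumn t hs.1 hle hU hn0 hn2 hR₁ hA₁ hLs hψ h1).trans
      (le_max_left _ _)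
  · exact (h.meanEnergy_anchor_le_of_rightColumn t hge hs.2 hU hn0 hn2 hR₂ hB₂ hLs hψ h1).trans
      (le_max_right _ _)

/-- **The anchor window of a cell ground state, from the outer columns**: same data,
`e(t,s₀,U,n) ≤ e_{Φ(t,s₀,U)}(ω) ≤ max (R₁ + (s₀ − s₁)A₁) (R₂ − (s₂ − s₀)B₂)` — the lower end is the
variational principle. [cite: Ruelle1969, §3.4] [cite: KomaTasaki1994, §1] -/
theorem IsTorusLimitOf.meanEnergy_anchor_mem_Icc_of_outerColumns (t : ℝ) {s₁ s₂ s₀ s : ℝ}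
    (hs : s ∈ Set.Icc s₁ s₂) {U : ℝ} (hU : 0 ≤ U) {n : ℝ} (hn0 : 0 ≤ n)
    (hn2 : n < 2) {R₁ A₁ R₂ B₂ : ℝ}
    (hR₁ : energyDensityTT' t s₁ U n ≤ R₁) (hR₂ : energyDensityTT' t s₂ U n ≤ R₂)
    (hA₁ : ∀ (ω₁ : InfVolFermionState 2) (Ls₁ : ℕ → ℕ) (ψ₁ : ∀ L, Fock (Orb (FermionTorus 2 L))),
      Tendsto Ls₁ atTop atTop →
      (∀ j, IsGroundStateInSector (hubbardTorusTT' (Ls₁ j) t s₁ U) (rectN n (Ls₁ j)) 0 (ψ₁ (Ls₁ j))) →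
      (∀ j, star (ψ₁ (Ls₁ j)) ⬝ᵥ ψ₁ (Ls₁ j) = 1) → ω₁.IsTorusLimitOf ψ₁ Ls₁ →
      ω₁.meanEnergy (hubbardTTPrimeFermionInteraction 0 1 0) 1 ≤ A₁)
    (hB₂ : ∀ (ω₂ : InfVolFermionState 2) (Ls₂ : ℕ → ℕ) (ψ₂ : ∀ L, Fock (Orb (FermionTorus 2 L))),
      Tendsto Ls₂ atTop atTop →
      (∀ j, IsGroundStateInSector (hubbardTorusTT' (Ls₂ j) t s₂ U) (rectN n (Ls₂ j)) 0 (ψ₂ (Ls₂ j))) →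
      (∀ j, star (ψ₂ (Ls₂ j)) ⬝ᵥ ψ₂ (Ls₂ j) = 1) → ω₂.IsTorusLimitOf ψ₂ Ls₂ →
      B₂ ≤ ω₂.meanEnergy (hubbardTTPrimeFermionInteraction 0 1 0) 1)
    {ω : InfVolFermionState 2} {ψ : ∀ L, Fock (Orb (FermionTorus 2 L))} {Ls : ℕ → ℕ}
    (h : ω.IsTorusLimitOf ψ Ls) (hLs : Tendsto Ls atTop atTop)
    (hψ : ∀ j, IsGroundStateInSector (hubbardTorusTT' (Ls j) t s U) (rectN n (Ls j)) 0 (ψ (Ls j)))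
    (h1 : ∀ j, star (ψ (Ls j)) ⬝ᵥ ψ (Ls j) = 1) :
    ω.meanEnergy (hubbardTTPrimeFermionInteraction t s₀ U) 1 ∈
      Set.Icc (energyDensityTT' t s₀ U n) (max (R₁ + (s₀ - s₁) * A₁) (R₂ - (s₂ - s₀) * B₂)) := by
  have hN : ∀ j, IsNParticle (rectN n (Ls j)) (ψ (Ls j)) := fun j =>
    ((mem_szSector_iff _ _ _).1 (hψ j).1).1
  exact ⟨h.energyDensityTT'_le_meanEnergy_hubbardTTPrime t s₀ hU hn0 hn2 hLs hN h1,
    h.meanEnergy_anchor_le_of_outerColumns t hs hU hn0 hn2 hR₁ hR₂ hA₁ hB₂ hLs hψ h1⟩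

/-! ### §2 Word-free: the far column's cap and the kinematic row `|K₂| ≤ 16/π²` -/

/-- **Anchor energy from a LEFT cap alone (kinematic).** For `s₁ ≤ s ≤ s₀`, a certified cap
`e(t,s₁,U,n) ≤ R₁` gives `e_{Φ(t,s₀,U)}(ω) ≤ R₁ + (16/π²)(s₀ − s₁)` for every torus-limit ground state
`ω` at `(t,s,U)` (kinematic cap transport `e(t,s,U,n) ≤ R₁ + (16/π²)(s − s₁)` and the kinematic row
`K₂(ω) ≤ 16/π²`) — the gap at `16/π²`, against `32/π²` for the one-anchor form.
[cite: LiebLoss1993, §8, Theorem 8.2] [cite: KomaTasaki1994, §1] -/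
theorem IsTorusLimitOf.meanEnergy_anchor_le_of_leftCap_kinematic (t : ℝ) {s₁ s s₀ : ℝ} (hs₁ : s₁ ≤ s)
    (hs₀ : s ≤ s₀) {U : ℝ} (hU : 0 ≤ U) {n : ℝ} (hn0 : 0 ≤ n) (hn2 : n < 2) {R₁ : ℝ}
    (hR₁ : energyDensityTT' t s₁ U n ≤ R₁)
    {ω : InfVolFermionState 2} {ψ : ∀ L, Fock (Orb (FermionTorus 2 L))} {Ls : ℕ → ℕ}
    (h : ω.IsTorusLimitOf ψ Ls) (hLs : Tendsto Ls atTop atTop)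
    (hψ : ∀ j, IsGroundStateInSector (hubbardTorusTT' (Ls j) t s U) (rectN n (Ls j)) 0 (ψ (Ls j)))
    (h1 : ∀ j, star (ψ (Ls j)) ⬝ᵥ ψ (Ls j) = 1) :
    ω.meanEnergy (hubbardTTPrimeFermionInteraction t s₀ U) 1 ≤ R₁ + 16 / Real.pi ^ 2 * (s₀ - s₁) := by
  have hN : ∀ j, IsNParticle (rectN n (Ls j)) (ψ (Ls j)) := fun j =>
    ((mem_szSector_iff _ _ _).1 (hψ j).1).1
  have haff := ω.meanEnergy_hubbardTTPrime_affine t s U s₀ U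
  have hgs := h.meanEnergy_hubbardTTPrime_eq_energyDensityTT' t s hU hn0 hn2 hLs hψ h1
  have hK := (abs_le.1 (h.abs_meanEnergy_diagHop_le hn0 hn2 hLs hN h1)).2
  have hup := energyDensityTT'_le_of_upperBound_tPrime_kinematic t hU hn0 hn2 (s' := s) hR₁
  rw [abs_of_nonneg (sub_nonneg.2 hs₁)] at hup
  have hprod := mul_le_mul_of_nonneg_left hK (sub_nonneg.2 hs₀)
  rw [haff, hgs, sub_self, zero_mul, add_zero]
  have e : R₁ + 16 / Real.pi ^ 2 * (s₀ - s₁) =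
      R₁ + 16 / Real.pi ^ 2 * (s - s₁) + (s₀ - s) * (16 / Real.pi ^ 2) := by ring
  rw [e]
  linarith

/-- **Anchor energy from a RIGHT cap alone (kinematic).** For `s₀ ≤ s ≤ s₂`, a certified cap
`e(t,s₂,U,n) ≤ R₂` gives `e_{Φ(t,s₀,U)}(ω) ≤ R₂ + (16/π²)(s₂ − s₀)` for every torus-limit ground state
`ω` at `(t,s,U)`. [cite: LiebLoss1993, §8, Theorem 8.2] [cite: KomaTasaki1994, §1] -/
theorem IsTorusLimitOf.meanEnergy_anchor_le_of_rightCap_kinematic (t : ℝ) {s₀ s s₂ : ℝ} (hs₀ : s₀ ≤ s)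
    (hs₂ : s ≤ s₂) {U : ℝ} (hU : 0 ≤ U) {n : ℝ} (hn0 : 0 ≤ n) (hn2 : n < 2) {R₂ : ℝ}
    (hR₂ : energyDensityTT' t s₂ U n ≤ R₂)
    {ω : InfVolFermionState 2} {ψ : ∀ L, Fock (Orb (FermionTorus 2 L))} {Ls : ℕ → ℕ}
    (h : ω.IsTorusLimitOf ψ Ls) (hLs : Tendsto Ls atTop atTop)
    (hψ : ∀ j, IsGroundStateInSector (hubbardTorusTT' (Ls j) t s U) (rectN n (Ls j)) 0 (ψ (Ls j)))
    (h1 : ∀ j, star (ψ (Ls j)) ⬝ᵥ ψ (Ls j) = 1) :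
    ω.meanEnergy (hubbardTTPrimeFermionInteraction t s₀ U) 1 ≤ R₂ + 16 / Real.pi ^ 2 * (s₂ - s₀) := by
  have hN : ∀ j, IsNParticle (rectN n (Ls j)) (ψ (Ls j)) := fun j =>
    ((mem_szSector_iff _ _ _).1 (hψ j).1).1
  have haff := ω.meanEnergy_hubbardTTPrime_affine t s U s₀ U
  have hgs := h.meanEnergy_hubbardTTPrime_eq_energyDensityTT' t s hU hn0 hn2 hLs hψ h1
  have hK := (abs_le.1 (h.abs_meanEnergy_diagHop_le hn0 hn2 hLs hN h1)).1
  have hup := energyDensityTT'_le_of_upperBound_tPrime_kinematic t hU hn0 hn2 (s' := s) hR₂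
  rw [abs_of_nonpos (sub_nonpos.2 hs₂)] at hup
  have hprod := mul_le_mul_of_nonpos_left hK (sub_nonpos.2 hs₀)
  rw [haff, hgs, sub_self, zero_mul, add_zero]
  have e : R₂ + 16 / Real.pi ^ 2 * (s₂ - s₀) =
      R₂ + 16 / Real.pi ^ 2 * (-(s - s₂)) + (s₀ - s) * (-(16 / Real.pi ^ 2)) := by ring
  rw [e]
  linarith

/-! ### §3 BOX ⇒ WORD: a cap-class certificate at the anchor, booked with the far column's tangent -/

/-- **BOX ⇒ WORD, cell left of the anchor.** Fix `t`, `U ≥ 0`, `0 ≤ n < 2`, a column `s₁ ≤ s₀` with a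
cap `e(t,s₁,U,n) ≤ R₁` and a ceiling word `A₁`, and a property `P` of infinite-volume states holding
for every torus limit (along some `Ls → ∞`) of unit `rectN n`-vectors whose anchor energy is capped,
`e_{Φ(t,s₀,U)}(ω) ≤ u` (a certificate at the anchor whose state hypotheses are the cap and
state-independent rows). If `R₁ + (s₀ − s₁)A₁ ≤ u`, then `P ω` for every torus-limit ground state `ω`
at every `t' = s ∈ [s₁, s₀]`. [cite: WangEtAl2024, §III] [cite: KomaTasaki1994, §1] -/
theorem forall_groundState_tPrime_cell_of_forall_cap_leftColumn (t : ℝ) {s₁ s₀ : ℝ}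
    {U : ℝ} (hU : 0 ≤ U) {n : ℝ} (hn0 : 0 ≤ n) (hn2 : n < 2) {R₁ A₁ u : ℝ}
    (hR₁ : energyDensityTT' t s₁ U n ≤ R₁)
    (hA₁ : ∀ (ω₁ : InfVolFermionState 2) (Ls₁ : ℕ → ℕ) (ψ₁ : ∀ L, Fock (Orb (FermionTorus 2 L))),
      Tendsto Ls₁ atTop atTop →
      (∀ j, IsGroundStateInSector (hubbardTorusTT' (Ls₁ j) t s₁ U) (rectN n (Ls₁ j)) 0 (ψ₁ (Ls₁ j))) →
      (∀ j, star (ψ₁ (Ls₁ j)) ⬝ᵥ ψ₁ (Ls₁ j) = 1) → ω₁.IsTorusLimitOf ψ₁ Ls₁ →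
      ω₁.meanEnergy (hubbardTTPrimeFermionInteraction 0 1 0) 1 ≤ A₁)
    (hu : R₁ + (s₀ - s₁) * A₁ ≤ u)
    {P : InfVolFermionState 2 → Prop}
    (hP : ∀ (ω : InfVolFermionState 2) (Ls : ℕ → ℕ) (ψ : ∀ L, Fock (Orb (FermionTorus 2 L))),
      Tendsto Ls atTop atTop → (∀ j, IsNParticle (rectN n (Ls j)) (ψ (Ls j))) →
      (∀ j, star (ψ (Ls j)) ⬝ᵥ ψ (Ls j) = 1) → ω.IsTorusLimitOf ψ Ls →
      ω.meanEnergy (hubbardTTPrimeFermionInteraction t s₀ U) 1 ≤ u → P ω)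
    {s : ℝ} (hs : s ∈ Set.Icc s₁ s₀)
    {ω : InfVolFermionState 2} {ψ : ∀ L, Fock (Orb (FermionTorus 2 L))} {Ls : ℕ → ℕ}
    (h : ω.IsTorusLimitOf ψ Ls) (hLs : Tendsto Ls atTop atTop)
    (hψ : ∀ j, IsGroundStateInSector (hubbardTorusTT' (Ls j) t s U) (rectN n (Ls j)) 0 (ψ (Ls j)))
    (h1 : ∀ j, star (ψ (Ls j)) ⬝ᵥ ψ (Ls j) = 1) : P ω := by
  have hN : ∀ j, IsNParticle (rectN n (Ls j)) (ψ (Ls j)) := fun j =>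
    ((mem_szSector_iff _ _ _).1 (hψ j).1).1
  exact hP ω Ls ψ hLs hN h1 h
    ((h.meanEnergy_anchor_le_of_leftColumn t hs.1 hs.2 hU hn0 hn2 hR₁ hA₁ hLs hψ h1).trans hu)

/-- **BOX ⇒ WORD, cell right of the anchor.** A column `s₂ ≥ s₀` with a cap `R₂` and a floor word
`B₂`; if `R₂ − (s₂ − s₀)B₂ ≤ u`, the anchor's cap-class property `P` holds for every torus-limit ground
state at every `t' = s ∈ [s₀, s₂]`. [cite: WangEtAl2024, §III] [cite: KomaTasaki1994, §1] -/
theorem forall_groundState_tPrime_cell_of_forall_cap_rightColumn (t : ℝ) {s₀ s₂ : ℝ}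
    {U : ℝ} (hU : 0 ≤ U) {n : ℝ} (hn0 : 0 ≤ n) (hn2 : n < 2) {R₂ B₂ u : ℝ}
    (hR₂ : energyDensityTT' t s₂ U n ≤ R₂)
    (hB₂ : ∀ (ω₂ : InfVolFermionState 2) (Ls₂ : ℕ → ℕ) (ψ₂ : ∀ L, Fock (Orb (FermionTorus 2 L))),
      Tendsto Ls₂ atTop atTop →
      (∀ j, IsGroundStateInSector (hubbardTorusTT' (Ls₂ j) t s₂ U) (rectN n (Ls₂ j)) 0 (ψ₂ (Ls₂ j))) →
      (∀ j, star (ψ₂ (Ls₂ j)) ⬝ᵥ ψ₂ (Ls₂ j) = 1) → ω₂.IsTorusLimitOf ψ₂ Ls₂ →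
      B₂ ≤ ω₂.meanEnergy (hubbardTTPrimeFermionInteraction 0 1 0) 1)
    (hu : R₂ - (s₂ - s₀) * B₂ ≤ u)
    {P : InfVolFermionState 2 → Prop}
    (hP : ∀ (ω : InfVolFermionState 2) (Ls : ℕ → ℕ) (ψ : ∀ L, Fock (Orb (FermionTorus 2 L))),
      Tendsto Ls atTop atTop → (∀ j, IsNParticle (rectN n (Ls j)) (ψ (Ls j))) →
      (∀ j, star (ψ (Ls j)) ⬝ᵥ ψ (Ls j) = 1) → ω.IsTorusLimitOf ψ Ls →
      ω.meanEnergy (hubbardTTPrimeFermionInteraction t s₀ U) 1 ≤ u → P ω)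
    {s : ℝ} (hs : s ∈ Set.Icc s₀ s₂)
    {ω : InfVolFermionState 2} {ψ : ∀ L, Fock (Orb (FermionTorus 2 L))} {Ls : ℕ → ℕ}
    (h : ω.IsTorusLimitOf ψ Ls) (hLs : Tendsto Ls atTop atTop)
    (hψ : ∀ j, IsGroundStateInSector (hubbardTorusTT' (Ls j) t s U) (rectN n (Ls j)) 0 (ψ (Ls j)))
    (h1 : ∀ j, star (ψ (Ls j)) ⬝ᵥ ψ (Ls j) = 1) : P ω := by
  have hN : ∀ j, IsNParticle (rectN n (Ls j)) (ψ (Ls j)) := fun j =>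
    ((mem_szSector_iff _ _ _).1 (hψ j).1).1
  exact hP ω Ls ψ hLs hN h1 h
    ((h.meanEnergy_anchor_le_of_rightColumn t hs.1 hs.2 hU hn0 hn2 hR₂ hB₂ hLs hψ h1).trans hu)

/-- **BOX ⇒ WORD, anchor with both outer columns.** Any anchor `s₀` (in practice in `[s₁, s₂]`), a cap
`R₁` + ceiling word `A₁` at `s₁`, a cap `R₂` + floor word `B₂` at `s₂`; if
`max (R₁ + (s₀ − s₁)A₁) (R₂ − (s₂ − s₀)B₂) ≤ u`, the anchor's cap-class property `P` holds for every
torus-limit ground state at every `t' = s ∈ [s₁, s₂]` (against the one-anchor booking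
`u₀ + max(s₂ − s₀, s₀ − s₁)(A − B)` of `forall_groundState_tPrime_box_of_forall_cap`).
[cite: WangEtAl2024, §III] [cite: KomaTasaki1994, §1] -/
theorem forall_groundState_tPrime_cell_of_forall_cap_outerColumns (t : ℝ) {s₁ s₂ s₀ : ℝ}
    {U : ℝ} (hU : 0 ≤ U) {n : ℝ} (hn0 : 0 ≤ n) (hn2 : n < 2)
    {R₁ A₁ R₂ B₂ u : ℝ}
    (hR₁ : energyDensityTT' t s₁ U n ≤ R₁) (hR₂ : energyDensityTT' t s₂ U n ≤ R₂)
    (hA₁ : ∀ (ω₁ : InfVolFermionState 2) (Ls₁ : ℕ → ℕ) (ψ₁ : ∀ L, Fock (Orb (FermionTorus 2 L))),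
      Tendsto Ls₁ atTop atTop →
      (∀ j, IsGroundStateInSector (hubbardTorusTT' (Ls₁ j) t s₁ U) (rectN n (Ls₁ j)) 0 (ψ₁ (Ls₁ j))) →
      (∀ j, star (ψ₁ (Ls₁ j)) ⬝ᵥ ψ₁ (Ls₁ j) = 1) → ω₁.IsTorusLimitOf ψ₁ Ls₁ →
      ω₁.meanEnergy (hubbardTTPrimeFermionInteraction 0 1 0) 1 ≤ A₁)
    (hB₂ : ∀ (ω₂ : InfVolFermionState 2) (Ls₂ : ℕ → ℕ) (ψ₂ : ∀ L, Fock (Orb (FermionTorus 2 L))),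
      Tendsto Ls₂ atTop atTop →
      (∀ j, IsGroundStateInSector (hubbardTorusTT' (Ls₂ j) t s₂ U) (rectN n (Ls₂ j)) 0 (ψ₂ (Ls₂ j))) →
      (∀ j, star (ψ₂ (Ls₂ j)) ⬝ᵥ ψ₂ (Ls₂ j) = 1) → ω₂.IsTorusLimitOf ψ₂ Ls₂ →
      B₂ ≤ ω₂.meanEnergy (hubbardTTPrimeFermionInteraction 0 1 0) 1)
    (hu : max (R₁ + (s₀ - s₁) * A₁) (R₂ - (s₂ - s₀) * B₂) ≤ u)
    {P : InfVolFermionState 2 → Prop}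
    (hP : ∀ (ω : InfVolFermionState 2) (Ls : ℕ → ℕ) (ψ : ∀ L, Fock (Orb (FermionTorus 2 L))),
      Tendsto Ls atTop atTop → (∀ j, IsNParticle (rectN n (Ls j)) (ψ (Ls j))) →
      (∀ j, star (ψ (Ls j)) ⬝ᵥ ψ (Ls j) = 1) → ω.IsTorusLimitOf ψ Ls →
      ω.meanEnergy (hubbardTTPrimeFermionInteraction t s₀ U) 1 ≤ u → P ω)
    {s : ℝ} (hs : s ∈ Set.Icc s₁ s₂)
    {ω : InfVolFermionState 2} {ψ : ∀ L, Fock (Orb (FermionTorus 2 L))} {Ls : ℕ → ℕ}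
    (h : ω.IsTorusLimitOf ψ Ls) (hLs : Tendsto Ls atTop atTop)
    (hψ : ∀ j, IsGroundStateInSector (hubbardTorusTT' (Ls j) t s U) (rectN n (Ls j)) 0 (ψ (Ls j)))
    (h1 : ∀ j, star (ψ (Ls j)) ⬝ᵥ ψ (Ls j) = 1) : P ω := by
  have hN : ∀ j, IsNParticle (rectN n (Ls j)) (ψ (Ls j)) := fun j =>
    ((mem_szSector_iff _ _ _).1 (hψ j).1).1
  exact hP ω Ls ψ hLs hN h1 h
    ((h.meanEnergy_anchor_le_of_outerColumns t hs hU hn0 hn2 hR₁ hR₂ hA₁ hB₂ hLs hψ h1).trans hu)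

/-- **BOX ⇒ WORD, word-free (two outer caps, kinematic row).** Caps `R₁` at `s₁` and `R₂` at `s₂`,
any anchor `s₀`; if `max (R₁ + (16/π²)(s₀ − s₁)) (R₂ + (16/π²)(s₂ − s₀)) ≤ u`, the anchor's
cap-class property `P` holds for every torus-limit ground state at every `t' ∈ [s₁, s₂]`.
[cite: WangEtAl2024, §III] [cite: LiebLoss1993, §8, Theorem 8.2] -/
theorem forall_groundState_tPrime_cell_of_forall_cap_outerCaps_kinematic (t : ℝ) {s₁ s₂ s₀ : ℝ}
    {U : ℝ} (hU : 0 ≤ U) {n : ℝ} (hn0 : 0 ≤ n) (hn2 : n < 2)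
    {R₁ R₂ u : ℝ}
    (hR₁ : energyDensityTT' t s₁ U n ≤ R₁) (hR₂ : energyDensityTT' t s₂ U n ≤ R₂)
    (hu : max (R₁ + 16 / Real.pi ^ 2 * (s₀ - s₁)) (R₂ + 16 / Real.pi ^ 2 * (s₂ - s₀)) ≤ u)
    {P : InfVolFermionState 2 → Prop}
    (hP : ∀ (ω : InfVolFermionState 2) (Ls : ℕ → ℕ) (ψ : ∀ L, Fock (Orb (FermionTorus 2 L))),
      Tendsto Ls atTop atTop → (∀ j, IsNParticle (rectN n (Ls j)) (ψ (Ls j))) →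
      (∀ j, star (ψ (Ls j)) ⬝ᵥ ψ (Ls j) = 1) → ω.IsTorusLimitOf ψ Ls →
      ω.meanEnergy (hubbardTTPrimeFermionInteraction t s₀ U) 1 ≤ u → P ω)
    {s : ℝ} (hs : s ∈ Set.Icc s₁ s₂)
    {ω : InfVolFermionState 2} {ψ : ∀ L, Fock (Orb (FermionTorus 2 L))} {Ls : ℕ → ℕ}
    (h : ω.IsTorusLimitOf ψ Ls) (hLs : Tendsto Ls atTop atTop)
    (hψ : ∀ j, IsGroundStateInSector (hubbardTorusTT' (Ls j) t s U) (rectN n (Ls j)) 0 (ψ (Ls j)))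
    (h1 : ∀ j, star (ψ (Ls j)) ⬝ᵥ ψ (Ls j) = 1) : P ω := by
  have hN : ∀ j, IsNParticle (rectN n (Ls j)) (ψ (Ls j)) := fun j =>
    ((mem_szSector_iff _ _ _).1 (hψ j).1).1
  refine hP ω Ls ψ hLs hN h1 h ?_
  rcases le_total s s₀ with hle | hge
  · exact ((h.meanEnergy_anchor_le_of_leftCap_kinematic t hs.1 hle hU hn0 hn2 hR₁ hLs hψ h1).trans
      (le_max_left _ _)).trans hu
  · exact ((h.meanEnergy_anchor_le_of_rightCap_kinematic t hge hs.2 hU hn0 hn2 hR₂ hLs hψ h1).trans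
      (le_max_right _ _)).trans hu

/-! ### §4 Cap-class WORDS with explicit cap slack, priced by the far column
(the twins of `IsTorusLimitOf.sub_mul_le_word_of_forall_capSlack`, DiagHop §6) -/

/-- **A cap-class word with explicit slack, LEFT column.** Cell `s₁ ≤ s ≤ s₀`, a cap `R₁` and a ceiling
word `A₁` at the column `s₁`; a real word certified at the anchor `s₀` with its cap slack explicit,
`c + κ·(u₀ − e_{Φ(t,s₀,U)}(ω)) ≤ f ω` for every torus limit of unit `rectN n`-vectors (`κ ≥ 0`). Then
every torus-limit ground state `ω` at `(t,s,U)` has `c − κ·(R₁ + (s₀ − s₁)A₁ − u₀) ≤ f ω` — uniform in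
`s`; the correction is a GAIN when the column's tangent at the anchor lies below the booked cap `u₀`.
[cite: WangEtAl2024, §III] [cite: KomaTasaki1994, §1] -/
theorem IsTorusLimitOf.sub_mul_le_word_of_forall_capSlack_leftColumn (t : ℝ) {s₁ s s₀ : ℝ}
    (hs₁ : s₁ ≤ s) (hs₀ : s ≤ s₀) {U : ℝ} (hU : 0 ≤ U) {n : ℝ} (hn0 : 0 ≤ n) (hn2 : n < 2)
    {R₁ A₁ u₀ κ c : ℝ} (hκ : 0 ≤ κ) (hR₁ : energyDensityTT' t s₁ U n ≤ R₁)
    (hA₁ : ∀ (ω₁ : InfVolFermionState 2) (Ls₁ : ℕ → ℕ) (ψ₁ : ∀ L, Fock (Orb (FermionTorus 2 L))),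
      Tendsto Ls₁ atTop atTop →
      (∀ j, IsGroundStateInSector (hubbardTorusTT' (Ls₁ j) t s₁ U) (rectN n (Ls₁ j)) 0 (ψ₁ (Ls₁ j))) →
      (∀ j, star (ψ₁ (Ls₁ j)) ⬝ᵥ ψ₁ (Ls₁ j) = 1) → ω₁.IsTorusLimitOf ψ₁ Ls₁ →
      ω₁.meanEnergy (hubbardTTPrimeFermionInteraction 0 1 0) 1 ≤ A₁)
    {f : InfVolFermionState 2 → ℝ}
    (hf : ∀ (ω : InfVolFermionState 2) (Ls : ℕ → ℕ) (ψ : ∀ L, Fock (Orb (FermionTorus 2 L))),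
      Tendsto Ls atTop atTop → (∀ j, IsNParticle (rectN n (Ls j)) (ψ (Ls j))) →
      (∀ j, star (ψ (Ls j)) ⬝ᵥ ψ (Ls j) = 1) → ω.IsTorusLimitOf ψ Ls →
      c + κ * (u₀ - ω.meanEnergy (hubbardTTPrimeFermionInteraction t s₀ U) 1) ≤ f ω)
    {ω : InfVolFermionState 2} {ψ : ∀ L, Fock (Orb (FermionTorus 2 L))} {Ls : ℕ → ℕ}
    (h : ω.IsTorusLimitOf ψ Ls) (hLs : Tendsto Ls atTop atTop)
    (hψ : ∀ j, IsGroundStateInSector (hubbardTorusTT' (Ls j) t s U) (rectN n (Ls j)) 0 (ψ (Ls j)))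
    (h1 : ∀ j, star (ψ (Ls j)) ⬝ᵥ ψ (Ls j) = 1) :
    c - κ * (R₁ + (s₀ - s₁) * A₁ - u₀) ≤ f ω := by
  have hN : ∀ j, IsNParticle (rectN n (Ls j)) (ψ (Ls j)) := fun j =>
    ((mem_szSector_iff _ _ _).1 (hψ j).1).1
  have hfω := hf ω Ls ψ hLs hN h1 h
  have hcap := h.meanEnergy_anchor_le_of_leftColumn t hs₁ hs₀ hU hn0 hn2 hR₁ hA₁ hLs hψ h1
  have hslack : -(R₁ + (s₀ - s₁) * A₁ - u₀) ≤
      u₀ - ω.meanEnergy (hubbardTTPrimeFermionInteraction t s₀ U) 1 := by linarith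
  have hκs := mul_le_mul_of_nonneg_left hslack hκ
  linarith

/-- **A cap-class word with explicit slack, RIGHT column.** Cell `s₀ ≤ s ≤ s₂`, a cap `R₂` and a floor
word `B₂` at `s₂`; same certified word at the anchor. Every torus-limit ground state `ω` at `(t,s,U)`
has `c − κ·(R₂ − (s₂ − s₀)B₂ − u₀) ≤ f ω`. [cite: WangEtAl2024, §III] [cite: KomaTasaki1994, §1] -/
theorem IsTorusLimitOf.sub_mul_le_word_of_forall_capSlack_rightColumn (t : ℝ) {s₀ s s₂ : ℝ}
    (hs₀ : s₀ ≤ s) (hs₂ : s ≤ s₂) {U : ℝ} (hU : 0 ≤ U) {n : ℝ} (hn0 : 0 ≤ n) (hn2 : n < 2)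
    {R₂ B₂ u₀ κ c : ℝ} (hκ : 0 ≤ κ) (hR₂ : energyDensityTT' t s₂ U n ≤ R₂)
    (hB₂ : ∀ (ω₂ : InfVolFermionState 2) (Ls₂ : ℕ → ℕ) (ψ₂ : ∀ L, Fock (Orb (FermionTorus 2 L))),
      Tendsto Ls₂ atTop atTop →
      (∀ j, IsGroundStateInSector (hubbardTorusTT' (Ls₂ j) t s₂ U) (rectN n (Ls₂ j)) 0 (ψ₂ (Ls₂ j))) →
      (∀ j, star (ψ₂ (Ls₂ j)) ⬝ᵥ ψ₂ (Ls₂ j) = 1) → ω₂.IsTorusLimitOf ψ₂ Ls₂ →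
      B₂ ≤ ω₂.meanEnergy (hubbardTTPrimeFermionInteraction 0 1 0) 1)
    {f : InfVolFermionState 2 → ℝ}
    (hf : ∀ (ω : InfVolFermionState 2) (Ls : ℕ → ℕ) (ψ : ∀ L, Fock (Orb (FermionTorus 2 L))),
      Tendsto Ls atTop atTop → (∀ j, IsNParticle (rectN n (Ls j)) (ψ (Ls j))) →
      (∀ j, star (ψ (Ls j)) ⬝ᵥ ψ (Ls j) = 1) → ω.IsTorusLimitOf ψ Ls →
      c + κ * (u₀ - ω.meanEnergy (hubbardTTPrimeFermionInteraction t s₀ U) 1) ≤ f ω)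
    {ω : InfVolFermionState 2} {ψ : ∀ L, Fock (Orb (FermionTorus 2 L))} {Ls : ℕ → ℕ}
    (h : ω.IsTorusLimitOf ψ Ls) (hLs : Tendsto Ls atTop atTop)
    (hψ : ∀ j, IsGroundStateInSector (hubbardTorusTT' (Ls j) t s U) (rectN n (Ls j)) 0 (ψ (Ls j)))
    (h1 : ∀ j, star (ψ (Ls j)) ⬝ᵥ ψ (Ls j) = 1) :
    c - κ * (R₂ - (s₂ - s₀) * B₂ - u₀) ≤ f ω := by
  have hN : ∀ j, IsNParticle (rectN n (Ls j)) (ψ (Ls j)) := fun j =>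
    ((mem_szSector_iff _ _ _).1 (hψ j).1).1
  have hfω := hf ω Ls ψ hLs hN h1 h
  have hcap := h.meanEnergy_anchor_le_of_rightColumn t hs₀ hs₂ hU hn0 hn2 hR₂ hB₂ hLs hψ h1
  have hslack : -(R₂ - (s₂ - s₀) * B₂ - u₀) ≤
      u₀ - ω.meanEnergy (hubbardTTPrimeFermionInteraction t s₀ U) 1 := by linarith
  have hκs := mul_le_mul_of_nonneg_left hslack hκ
  linarith

/-- **A cap-class word with explicit slack, both outer columns.** Cell `[s₁, s₂] ∋ s`, any anchor `s₀`
(in practice in the cell); caps and words at both columns; every torus-limit ground state `ω` at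
`(t,s,U)` has `c − κ·(max (R₁ + (s₀ − s₁)A₁) (R₂ − (s₂ − s₀)B₂) − u₀) ≤ f ω` (against DiagHop §6's
`c − κ·|s − s₀|(A − B)` with the anchor's own words). [cite: WangEtAl2024, §III] [cite: KomaTasaki1994, §1] -/
theorem IsTorusLimitOf.sub_mul_le_word_of_forall_capSlack_outerColumns (t : ℝ) {s₁ s₂ s₀ s : ℝ}
    (hs : s ∈ Set.Icc s₁ s₂) {U : ℝ} (hU : 0 ≤ U) {n : ℝ} (hn0 : 0 ≤ n) (hn2 : n < 2)
    {R₁ A₁ R₂ B₂ u₀ κ c : ℝ} (hκ : 0 ≤ κ)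
    (hR₁ : energyDensityTT' t s₁ U n ≤ R₁) (hR₂ : energyDensityTT' t s₂ U n ≤ R₂)
    (hA₁ : ∀ (ω₁ : InfVolFermionState 2) (Ls₁ : ℕ → ℕ) (ψ₁ : ∀ L, Fock (Orb (FermionTorus 2 L))),
      Tendsto Ls₁ atTop atTop →
      (∀ j, IsGroundStateInSector (hubbardTorusTT' (Ls₁ j) t s₁ U) (rectN n (Ls₁ j)) 0 (ψ₁ (Ls₁ j))) →
      (∀ j, star (ψ₁ (Ls₁ j)) ⬝ᵥ ψ₁ (Ls₁ j) = 1) → ω₁.IsTorusLimitOf ψ₁ Ls₁ →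
      ω₁.meanEnergy (hubbardTTPrimeFermionInteraction 0 1 0) 1 ≤ A₁)
    (hB₂ : ∀ (ω₂ : InfVolFermionState 2) (Ls₂ : ℕ → ℕ) (ψ₂ : ∀ L, Fock (Orb (FermionTorus 2 L))),
      Tendsto Ls₂ atTop atTop →
      (∀ j, IsGroundStateInSector (hubbardTorusTT' (Ls₂ j) t s₂ U) (rectN n (Ls₂ j)) 0 (ψ₂ (Ls₂ j))) →
      (∀ j, star (ψ₂ (Ls₂ j)) ⬝ᵥ ψ₂ (Ls₂ j) = 1) → ω₂.IsTorusLimitOf ψ₂ Ls₂ →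
      B₂ ≤ ω₂.meanEnergy (hubbardTTPrimeFermionInteraction 0 1 0) 1)
    {f : InfVolFermionState 2 → ℝ}
    (hf : ∀ (ω : InfVolFermionState 2) (Ls : ℕ → ℕ) (ψ : ∀ L, Fock (Orb (FermionTorus 2 L))),
      Tendsto Ls atTop atTop → (∀ j, IsNParticle (rectN n (Ls j)) (ψ (Ls j))) →
      (∀ j, star (ψ (Ls j)) ⬝ᵥ ψ (Ls j) = 1) → ω.IsTorusLimitOf ψ Ls →
      c + κ * (u₀ - ω.meanEnergy (hubbardTTPrimeFermionInteraction t s₀ U) 1) ≤ f ω)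
    {ω : InfVolFermionState 2} {ψ : ∀ L, Fock (Orb (FermionTorus 2 L))} {Ls : ℕ → ℕ}
    (h : ω.IsTorusLimitOf ψ Ls) (hLs : Tendsto Ls atTop atTop)
    (hψ : ∀ j, IsGroundStateInSector (hubbardTorusTT' (Ls j) t s U) (rectN n (Ls j)) 0 (ψ (Ls j)))
    (h1 : ∀ j, star (ψ (Ls j)) ⬝ᵥ ψ (Ls j) = 1) :
    c - κ * (max (R₁ + (s₀ - s₁) * A₁) (R₂ - (s₂ - s₀) * B₂) - u₀) ≤ f ω := by
  have hN : ∀ j, IsNParticle (rectN n (Ls j)) (ψ (Ls j)) := fun j =>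
    ((mem_szSector_iff _ _ _).1 (hψ j).1).1
  have hfω := hf ω Ls ψ hLs hN h1 h
  have hcap := h.meanEnergy_anchor_le_of_outerColumns t (s₀ := s₀) hs hU hn0 hn2 hR₁ hR₂ hA₁ hB₂ hLs
    hψ h1
  have hslack : -(max (R₁ + (s₀ - s₁) * A₁) (R₂ - (s₂ - s₀) * B₂) - u₀) ≤
      u₀ - ω.meanEnergy (hubbardTTPrimeFermionInteraction t s₀ U) 1 := by linarith
  have hκs := mul_le_mul_of_nonneg_left hslack hκ
  linarith

end InfVolFermionState

end Literature.MathematicalPhysics.QuantumLattice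

end
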